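import Mathlib
import Literature.NumberTheory.DiophantineGeometry.PartitionTableaux
import Literature.NumberTheory.DiophantineGeometry.StandardFillings
import Summits.MatrixMultiplication.MatrixMultiplication.Theorems.SnSubsetDichotomyPolynomialSlackSpechtBranching
import Summits.MatrixMultiplication.MatrixMultiplication.Theorems.SnSubsetDichotomyPolynomialSlackSpechtDimLower
import HarnessLib

/-!
# The linear lower bound for Specht dimensions: `f^λ ≥ n - 1` off the one-row and one-column shapes

Helper file (1/3) of the discharge of the named fact
`Literature.RepresentationTheory.FiniteGroups.JamesKerber1981_thm_2_5_15` (minimal degree `n - 1` of the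
alternating group), filed for route MonotoneRestoration, crux `OrbitRestorationQP`
(stmt-ValiantsHypothesis-18293), line `mixing-scale`: its registered input `alternatingProductMixing`
(Babai–Nikolov–Pyber product mixing in `𝔄_n`) is reduced in the tree to that fact
(`Literature.GroupTheory.QuasirandomGroups.alternatingProductMixing_of_minDegree`).

Main result, on Young diagrams (`f^Y = #` standard fillings of `Y`, the tree's `StdFilling`):

* `linear_le_syt` — **for every Young diagram `Y` with `|Y| ≥ 5` cells which is neither a single row
  nor a single column, `|Y| - 1 ≤ f^Y`** (sharp at `(n-1,1)`, `(2,1^{n-2})`, `(3,3)`, `(2,2,2)`);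
* `sub_one_le_numStandardTableaux` — the same for partitions `μ ⊢ n`.

This is the combinatorial half of the classical fact that the minimal degree of a faithful complex
character of `𝔖_n` (`n ≥ 5`) is `n - 1` (James–Kerber 2.4.10; Rasala 1977); the tree's
`…PolynomialSlackMinDegree` had only `⌊n/4⌋`.  Proof: strong induction on `|Y|` over diagrams, by the
branching inequalities of `…PolynomialSlackSpechtBranching` (`f^{Y ⊖ c} + f^{Y ⊖ c'} ≤ f^Y` for two corner
rows): a first row (or, transposing, first column) of exactly `|Y| - 1` cells is the hook `(m-1,1)`,
handled by its two corners; otherwise two corner rows give `2(m-2) ≥ m-1`, and a rectangle `a × b` is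
bounded through the two corners of its unique child (`(a^{b-1}, a-1)`), with the single exceptional value
`f^{(2,2)} = 2` carried along as a correction term (`… + if m = 4 ∧ rowLen 0 = 2 then 1 else 0`).

References: G. James, A. Kerber, *The Representation Theory of the Symmetric Group* (1981), 2.4.10;
R. Rasala, *On the minimal degrees of characters of `S_n`*, J. Algebra 45 (1977); G. James, LNM 682, §9.
Honest framing: pure combinatorics; nothing here bears on `VP ≠ VNP`.
-/

namespace Summit.ValiantsHypothesis.ValiantsHypothesis.Theorems.OrbitRestorationQPMixingScale.SpechtDim

open Literature.NumberTheory.DiophantineGeometry Literature.RepresentationTheory.FiniteGroups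
open Summit.MatrixMultiplication.MatrixMultiplication.Theorems.PolynomialSlack

-- `Summit.ValiantsHypothesis.ValiantsHypothesis.…` is the tree's single-conjunct layout (Sub = Summit).
set_option linter.dupNamespace false

/-! ## Diagram bookkeeping -/

/-- A diagram sits inside the box `colLen 0 × rowLen 0`, so `|Y| ≤ rowLen 0 · colLen 0`. [folklore] -/
theorem card_le_rowLen_mul_colLen (Y : YoungDiagram) : Y.cells.card ≤ Y.rowLen 0 * Y.colLen 0 := by
  have hsub : Y.cells ⊆ (Finset.range (Y.colLen 0)) ×ˢ (Finset.range (Y.rowLen 0)) := by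
    rintro ⟨i, j⟩ hc
    have hc' : (i, j) ∈ Y := (YoungDiagram.mem_cells _).1 hc
    rw [Finset.mem_product, Finset.mem_range, Finset.mem_range]
    exact ⟨lt_of_lt_of_le (YoungDiagram.mem_iff_lt_colLen.1 hc') (Y.colLen_anti 0 j (Nat.zero_le _)),
      lt_of_lt_of_le (YoungDiagram.mem_iff_lt_rowLen.1 hc') (Y.rowLen_anti 0 i (Nat.zero_le _))⟩
  calc Y.cells.card ≤ ((Finset.range (Y.colLen 0)) ×ˢ (Finset.range (Y.rowLen 0))).card :=
        Finset.card_le_card hsub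
    _ = Y.rowLen 0 * Y.colLen 0 := by
        rw [Finset.card_product, Finset.card_range, Finset.card_range, mul_comm]

/-- In a rectangle with `b = colLen 0` rows of length `a`, every column `j < a` has length `b`.
[folklore] -/
theorem colLen_eq_of_rect {Y : YoungDiagram} {a b : ℕ} (hrows : ∀ r, r < b → Y.rowLen r = a)
    (hcol : Y.colLen 0 = b) {j : ℕ} (hj : j < a) : Y.colLen j = b := by
  refine YoungDiagram.colLen_eq_of_forall_mem_iff fun i => ?_
  rw [YoungDiagram.mem_iff_lt_rowLen]
  constructor
  · intro h
    by_contra hib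
    rw [VershikKerov.rowLen_eq_zero Y (by rw [hcol]; omega)] at h
    exact absurd h (Nat.not_lt_zero _)
  · intro hib
    rw [hrows i hib]
    exact hj

/-- Removing a corner from a diagram whose first row and first column have at most `|Y| - 2` cells
leaves a diagram that is neither a row nor a column. [folklore] -/
theorem removeAbove_not_line {Y : YoungDiagram} {r n : ℕ} (h : Y.rowLen (r + 1) < Y.rowLen r)
    (hY : Y.cells.card = n + 1) (ha : Y.rowLen 0 + 2 ≤ n + 1) (hb : Y.colLen 0 + 2 ≤ n + 1) :
    (Y.removeAbove (r, Y.rowLen r - 1)).cells.card = n ∧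
      (Y.removeAbove (r, Y.rowLen r - 1)).rowLen 0 + 1 ≤ n ∧
      (Y.removeAbove (r, Y.rowLen r - 1)).colLen 0 + 1 ≤ n := by
  refine ⟨card_removeAbove_cornerCell h hY, ?_, ?_⟩
  · have := rowLen_le_of_le (removeAbove_le Y (r, Y.rowLen r - 1)) 0; omega
  · have := colLen_le_of_le (removeAbove_le Y (r, Y.rowLen r - 1)) 0; omega

/-! ## The induction -/

/-- **The hook `(m-1, 1)`.**  If the first row of `Y` has exactly `|Y| - 1 = m - 1` cells and `Y` is not
a row, then `Y = (m-1, 1)` and `m - 1 ≤ f^Y`, granted the bound for the smaller hook `(m-2, 1)`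
(induction hypothesis `ih`, with its correction term). [folklore] -/
theorem hook_two_rows_bound (m : ℕ)
    (ih : ∀ m' < m, ∀ Y' : YoungDiagram, Y'.cells.card = m' → Y'.rowLen 0 + 1 ≤ m' →
      Y'.colLen 0 + 1 ≤ m' → m' ≤ Nat.card (StdFilling Y'.cells.card Y') + 1 +
        (if m' = 4 ∧ Y'.rowLen 0 = 2 then 1 else 0))
    (Y : YoungDiagram) (hY : Y.cells.card = m) (hrow : Y.rowLen 0 + 1 = m) (hcol : Y.colLen 0 + 1 ≤ m) :
    m ≤ Nat.card (StdFilling Y.cells.card Y) + 1 := by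
  -- `Y` has exactly two rows, of lengths `m - 1` and `1`
  have hc2 : 2 ≤ Y.colLen 0 := by
    by_contra hlt
    have := card_eq_rowLen_of_colLen_le_one (Y := Y) (by omega)
    omega
  obtain ⟨k, hk⟩ : ∃ k, Y.colLen 0 = k + 1 := ⟨Y.colLen 0 - 1, by omega⟩
  have hsum := card_eq_sum_rowLen Y
  rw [hY, hk, Finset.sum_range_succ'] at hsum
  have hterms : ∀ r ∈ Finset.range k, 1 ≤ Y.rowLen (r + 1) := fun r hr =>
    one_le_rowLen_of_lt_colLen (by rw [hk]; have := Finset.mem_range.1 hr; omega)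
  have hksum : (Finset.range k).card • 1 ≤ ∑ r ∈ Finset.range k, Y.rowLen (r + 1) :=
    Finset.card_nsmul_le_sum _ _ 1 hterms
  rw [Finset.card_range, smul_eq_mul, mul_one] at hksum
  have hk1 : k = 1 := by omega
  subst hk1
  have hr1 : Y.rowLen 1 = 1 := by
    simp only [Finset.sum_range_one, zero_add] at hsum
    omega
  have hr2 : Y.rowLen 2 = 0 := VershikKerov.rowLen_eq_zero Y (by omega)
  have hm3 : 3 ≤ m := by omega
  -- the two corner rows `0` and `1`
  have h0 : Y.rowLen (0 + 1) < Y.rowLen 0 := by rw [hr1]; omega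
  have h1 : Y.rowLen (1 + 1) < Y.rowLen 1 := by rw [hr2, hr1]; omega
  have hbr := add_le_syt_of_isCornerRow h0 h1 (by omega)
  have hone := one_le_card_stdFilling (Y.removeAbove (1, Y.rowLen 1 - 1))
  obtain ⟨n, rfl⟩ : ∃ n, m = n + 1 := ⟨m - 1, by omega⟩
  have hc0 : (Y.removeAbove (0, Y.rowLen 0 - 1)).cells.card = n := card_removeAbove_cornerCell h0 hY
  have hr0' : (Y.removeAbove (0, Y.rowLen 0 - 1)).rowLen 0 = n - 1 := by
    rw [rowLen_removeAbove_cornerCell_self h0]; omega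
  have hcol' : (Y.removeAbove (0, Y.rowLen 0 - 1)).colLen 0 ≤ 2 := by
    have := colLen_le_of_le (removeAbove_le Y (0, Y.rowLen 0 - 1)) 0; omega
  -- `m = 3`: both children contribute `1`
  by_cases hn2 : n = 2
  · subst hn2
    have := one_le_card_stdFilling (Y.removeAbove (0, Y.rowLen 0 - 1))
    omega
  -- `m ≥ 4`: the child `(m-2, 1)` is neither a row nor a column
  have i0 := ih n (by omega) _ hc0 (by omega) (by omega)
  rw [if_neg (by omega)] at i0
  omega

/-- **A rectangle `a × b` with `a ≥ 3`, `b ≥ 2`.**  Then `ab - 1 ≤ f^Y`, granted the bound for the two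
corners of the unique child `(a^{b-1}, a-1)` (induction hypothesis `ih`). [folklore] -/
theorem rect_bound (m : ℕ)
    (ih : ∀ m' < m, ∀ Y' : YoungDiagram, Y'.cells.card = m' → Y'.rowLen 0 + 1 ≤ m' →
      Y'.colLen 0 + 1 ≤ m' → m' ≤ Nat.card (StdFilling Y'.cells.card Y') + 1 +
        (if m' = 4 ∧ Y'.rowLen 0 = 2 then 1 else 0))
    (Y : YoungDiagram) {a b : ℕ} (hY : Y.cells.card = m) (hm : m = a * b) (ha : 3 ≤ a) (hb : 2 ≤ b)
    (hrows : ∀ r, r < b → Y.rowLen r = a) (hcolY : Y.colLen 0 = b) :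
    m ≤ Nat.card (StdFilling Y.cells.card Y) + 1 := by
  have hab2 : a * 2 ≤ a * b := Nat.mul_le_mul_left a hb
  have hab3 : 3 * b ≤ a * b := Nat.mul_le_mul_right b ha
  have hm6 : 6 ≤ m := by omega
  obtain ⟨n, rfl⟩ : ∃ n, m = n + 1 := ⟨m - 1, by omega⟩
  obtain ⟨k, rfl⟩ : ∃ k, n = k + 1 := ⟨n - 1, by omega⟩
  have hrowb : Y.rowLen b = 0 := VershikKerov.rowLen_eq_zero Y (by rw [hcolY])
  have hlast : Y.rowLen (b - 1 + 1) < Y.rowLen (b - 1) := by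
    rw [show b - 1 + 1 = b by omega, hrowb, hrows (b - 1) (by omega)]; omega
  -- the unique child `Z = (a^{b-1}, a-1)`
  set Z := Y.removeAbove (b - 1, Y.rowLen (b - 1) - 1) with hZ
  have cZ : Z.cells.card = k + 1 := card_removeAbove_cornerCell hlast hY
  have hZrow : ∀ r, r < b - 1 → Z.rowLen r = a := fun r hr => by
    rw [hZ, rowLen_removeAbove_cornerCell_of_ne hlast (by omega)]; exact hrows r (by omega)
  have hZlast : Z.rowLen (b - 1) = a - 1 := by
    rw [hZ, rowLen_removeAbove_cornerCell_self hlast, hrows (b - 1) (by omega)]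
  have hZb : Z.rowLen b = 0 := by
    rw [hZ, rowLen_removeAbove_cornerCell_of_ne hlast (by omega)]; exact hrowb
  have hc1 : Z.rowLen (b - 1 + 1) < Z.rowLen (b - 1) := by
    rw [show b - 1 + 1 = b by omega, hZb, hZlast]; omega
  have hc2 : Z.rowLen (b - 2 + 1) < Z.rowLen (b - 2) := by
    rw [show b - 2 + 1 = b - 1 by omega, hZlast, hZrow (b - 2) (by omega)]; omega
  have hZY : Nat.card (StdFilling Z.cells.card Z) ≤ Nat.card (StdFilling Y.cells.card Y) :=
    le_syt_of_isCornerRow hlast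
  have hsum := add_le_syt_of_isCornerRow hc1 hc2 (by omega)
  -- the two grandchildren
  have c1 : (Z.removeAbove (b - 1, Z.rowLen (b - 1) - 1)).cells.card = k := card_removeAbove_cornerCell hc1 cZ
  have c2 : (Z.removeAbove (b - 2, Z.rowLen (b - 2) - 1)).cells.card = k := card_removeAbove_cornerCell hc2 cZ
  have hcolZ : Z.colLen 0 ≤ b := by
    have := colLen_le_of_le (removeAbove_le Y (b - 1, Y.rowLen (b - 1) - 1)) 0
    rw [← hZ] at this; omega
  have b1 : (Z.removeAbove (b - 1, Z.rowLen (b - 1) - 1)).colLen 0 ≤ b :=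
    (colLen_le_of_le (removeAbove_le Z _) 0).trans hcolZ
  have b2 : (Z.removeAbove (b - 2, Z.rowLen (b - 2) - 1)).colLen 0 ≤ b :=
    (colLen_le_of_le (removeAbove_le Z _) 0).trans hcolZ
  have a1 : (Z.removeAbove (b - 1, Z.rowLen (b - 1) - 1)).rowLen 0 = a := by
    rw [rowLen_removeAbove_cornerCell_of_ne hc1 (by omega)]; exact hZrow 0 (by omega)
  have i1 := ih k (by omega) _ c1 (by omega) (by omega)
  rw [if_neg (by omega)] at i1
  by_cases hb2 : b = 2
  · subst hb2
    have a2 : (Z.removeAbove (2 - 2, Z.rowLen (2 - 2) - 1)).rowLen 0 = a - 1 := by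
      rw [show (2 : ℕ) - 2 = 0 from rfl, rowLen_removeAbove_cornerCell_self (r := 0) (by simpa using hc2),
        hZrow 0 (by omega)]
    have i2 := ih k (by omega) _ c2 (by omega) (by omega)
    split_ifs at i2 with hδ
    · omega
    · omega
  · have a2 : (Z.removeAbove (b - 2, Z.rowLen (b - 2) - 1)).rowLen 0 = a := by
      rw [rowLen_removeAbove_cornerCell_of_ne hc2 (by omega)]; exact hZrow 0 (by omega)
    have i2 := ih k (by omega) _ c2 (by omega) (by omega)
    rw [if_neg (by omega)] at i2
    omega

/-- **The induction.**  For every Young diagram `Y` with `m` cells which is neither a single row nor a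
single column (`rowLen 0, colLen 0 ≤ m - 1`), `m ≤ f^Y + 1`, except for the square `(2,2)` where
`f = 2` (the correction term). [folklore] -/
theorem linear_le_syt_aux : ∀ (m : ℕ) (Y : YoungDiagram), Y.cells.card = m →
    Y.rowLen 0 + 1 ≤ m → Y.colLen 0 + 1 ≤ m →
    m ≤ Nat.card (StdFilling Y.cells.card Y) + 1 + (if m = 4 ∧ Y.rowLen 0 = 2 then 1 else 0) := by
  intro m
  induction m using Nat.strong_induction_on with
  | _ m ih =>
    intro Y hY ha hb
    have hf1 := one_le_card_stdFilling Y
    by_cases hm2 : m ≤ 2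
    · have : m ≤ Nat.card (StdFilling Y.cells.card Y) + 1 := by omega
      exact le_add_right this
    -- case (i): first row of length `m - 1`
    by_cases hA : Y.rowLen 0 + 1 = m
    · exact le_add_right (hook_two_rows_bound m ih Y hY hA hb)
    -- case (ii): first column of length `m - 1` (transpose)
    by_cases hB : Y.colLen 0 + 1 = m
    · have hY' : Y.transpose.cells.card = m := by rw [YoungDiagram.card_transpose, hY]
      have key := hook_two_rows_bound m ih Y.transpose hY' (by rw [YoungDiagram.rowLen_transpose]; exact hB)
        (by rw [YoungDiagram.colLen_transpose]; exact ha)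
      rw [card_stdFilling_transpose'] at key
      exact le_add_right key
    -- case (iii): both at most `m - 2`
    have ha2 : Y.rowLen 0 + 2 ≤ m := by omega
    have hb2 : Y.colLen 0 + 2 ≤ m := by omega
    have hm4 : 4 ≤ m := by
      by_contra hlt
      have hbox := card_le_rowLen_mul_colLen Y
      have : Y.rowLen 0 * Y.colLen 0 ≤ 1 * 1 := Nat.mul_le_mul (by omega) (by omega)
      omega
    obtain ⟨n, rfl⟩ : ∃ n, m = n + 1 := ⟨m - 1, by omega⟩
    have hcol : 1 ≤ Y.colLen 0 := one_le_colLen_of_card_pos (by omega)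
    have hlast : Y.rowLen (Y.colLen 0 - 1 + 1) < Y.rowLen (Y.colLen 0 - 1) := isCornerRow_last hcol
    by_cases hex : ∃ r, r + 1 < Y.colLen 0 ∧ Y.rowLen (r + 1) < Y.rowLen r
    · -- two distinct corner rows
      obtain ⟨r, hr, hcr⟩ := hex
      obtain ⟨c1, a1, b1⟩ := removeAbove_not_line hcr hY ha2 hb2
      obtain ⟨c2, a2, b2⟩ := removeAbove_not_line hlast hY ha2 hb2
      have i1 := ih n (by omega) _ c1 a1 b1
      have i2 := ih n (by omega) _ c2 a2 b2
      have hsum := add_le_syt_of_isCornerRow hcr hlast (by omega)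
      split_ifs at i1 i2 ⊢ <;> omega
    · -- a rectangle `a × b`
      push Not at hex
      have hrect : ∀ r, r < Y.colLen 0 → Y.rowLen r = Y.rowLen 0 := fun r hr =>
        rowLen_eq_rowLen_zero_of_no_corner (fun r hr => not_lt.2 (hex r hr)) hr
      have hab : n + 1 = Y.rowLen 0 * Y.colLen 0 := hY ▸ card_eq_mul_of_rect hrect
      have ha2' : 2 ≤ Y.rowLen 0 := by
        by_contra hlt
        have := card_eq_colLen_of_rowLen_le_one (Y := Y) (by omega)
        omega
      have hb2' : 2 ≤ Y.colLen 0 := by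
        by_contra hlt
        have := card_eq_rowLen_of_colLen_le_one (Y := Y) (by omega)
        omega
      by_cases h22 : Y.rowLen 0 = 2 ∧ Y.colLen 0 = 2
      · -- the square `(2,2)`: `f ≥ f^{(2,1)} = 2`
        obtain ⟨hr2, hc2⟩ := h22
        rw [hr2, hc2] at hab
        have hn3 : n = 3 := by omega
        subst hn3
        rw [if_pos ⟨rfl, hr2⟩]
        have hZY := le_syt_of_isCornerRow hlast
        have cZ : (Y.removeAbove (Y.colLen 0 - 1, Y.rowLen (Y.colLen 0 - 1) - 1)).cells.card = 3 :=
          card_removeAbove_cornerCell hlast hY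
        have aZ : (Y.removeAbove (Y.colLen 0 - 1, Y.rowLen (Y.colLen 0 - 1) - 1)).rowLen 0 = 2 := by
          rw [rowLen_removeAbove_cornerCell_of_ne hlast (by omega), hr2]
        have bZ : (Y.removeAbove (Y.colLen 0 - 1, Y.rowLen (Y.colLen 0 - 1) - 1)).colLen 0 ≤ 2 := by
          have := colLen_le_of_le (removeAbove_le Y (Y.colLen 0 - 1, Y.rowLen (Y.colLen 0 - 1) - 1)) 0
          omega
        have iZ := ih 3 (by omega) _ cZ (by omega) (by omega)
        rw [if_neg (by omega)] at iZ
        omega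
      · rw [if_neg (by omega)]
        by_cases hle : Y.colLen 0 ≤ Y.rowLen 0
        · have ha3 : 3 ≤ Y.rowLen 0 := by omega
          exact le_add_right (rect_bound (n + 1) ih Y hY hab ha3 hb2' hrect rfl)
        · -- transpose: `b × a` with `b ≥ 3`
          have hb3 : 3 ≤ Y.colLen 0 := by omega
          have hY' : Y.transpose.cells.card = n + 1 := by rw [YoungDiagram.card_transpose, hY]
          have hrows' : ∀ r, r < Y.rowLen 0 → Y.transpose.rowLen r = Y.colLen 0 := fun r hr => by
            rw [YoungDiagram.rowLen_transpose]
            exact colLen_eq_of_rect hrect rfl hr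
          have key := rect_bound (n + 1) ih Y.transpose hY' (by rw [hab, mul_comm]) hb3 ha2' hrows'
            (by rw [YoungDiagram.colLen_transpose])
          rw [card_stdFilling_transpose'] at key
          exact le_add_right key

/-- **The linear lower bound.**  For every Young diagram `Y` with `|Y| ≥ 5` which is neither a single row
nor a single column, `|Y| - 1 ≤ f^Y` (as `|Y| ≤ f^Y + 1`). [folklore] -/
theorem linear_le_syt {Y : YoungDiagram} (h5 : 5 ≤ Y.cells.card) (hrow : Y.rowLen 0 + 1 ≤ Y.cells.card)
    (hcol : Y.colLen 0 + 1 ≤ Y.cells.card) :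
    Y.cells.card ≤ Nat.card (StdFilling Y.cells.card Y) + 1 := by
  have h := linear_le_syt_aux Y.cells.card Y rfl hrow hcol
  rw [if_neg (by omega)] at h
  simpa using h

/-- **The linear lower bound for partitions**: for `μ ⊢ n`, `n ≥ 5`, all of whose parts are `≤ n - 1`
and which has at most `n - 1` parts (i.e. `μ ≠ (n), (1ⁿ)`), `n - 1 ≤ f^μ`. [folklore] -/
theorem sub_one_le_numStandardTableaux {n : ℕ} (hn : 5 ≤ n) (μ : Nat.Partition n)
    (hrow : ∀ a ∈ μ.parts, a + 1 ≤ n) (hcol : μ.parts.card + 1 ≤ n) :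
    n - 1 ≤ numStandardTableaux μ := by
  rw [numStandardTableaux_eq_card_stdFilling']
  have hc := μ.card_cells_youngDiagram
  have h1 : μ.youngDiagram.rowLen 0 + 1 ≤ μ.youngDiagram.cells.card := by
    rw [hc]
    rcases rowLen_zero_mem_parts_or μ with h | h
    · exact hrow _ h
    · omega
  have h2 : μ.youngDiagram.colLen 0 + 1 ≤ μ.youngDiagram.cells.card := by
    rw [hc, colLen_zero_youngDiagram]; exact hcol
  have key := linear_le_syt (by omega) h1 h2
  omega

end Summit.ValiantsHypothesis.ValiantsHypothesis.Theorems.OrbitRestorationQPMixingScale.SpechtDim
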